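/-
Copyright: the b2b-balaban T⁴-continuum CRUX team, row NE7b leaf lineage `t4-ne7b-formalise-leaf-02` (gen 135). Project licence.
-/
import Summits.QuantumFields.BalabanUV.T4Continuum.Spine.NE7b.FullFormSineFloor
import Summits.QuantumFields.BalabanUV.T4Continuum.Spine.NE7b.AverageTermsPrinted

/-!
# THE FULL-FORM (h2) FLOOR AT k = 1 WITH THE AVERAGE FAMILY READ FROM PRINT's (125): `…FullFormSineFloor.ims_floor_full_form` with its average-family
# parameters `(ω, w′, hw′, Y, hY)` DISCHARGED by `…AverageTermsPrinted` — `ω = n^{−(d+1)}`, `w′` the background transports along tree-contour-then-segment,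
# `Y_j(B) = ‖(Q₀(V₀)(lift B))(n·y, κ)‖` — so that on `good`
# `((c_loc − (1+t⁻¹)·(ε_curl + ε_avg))∕(1+t))·Σ_c‖B c‖² ≤ Σ_P X_P(B)² + Σ_{(y,κ)} ‖(Q₀(V₀)(lift B))(n·y, κ)‖²`, `ε_avg = (n^{d+1}+1)2^d·(n^{−(d+1)}·n)²·((d+1)(n−1)π∕2L)²·n^{d+1}·n`
# (row NE7b, node U5c; residual (R2′) family (2), letter (ℓ1); capstone junction — the printed instance of `…FullFormSineFloor`)

Cell `pub-balaban`, sub-cell `t4`, spine estimate NE7b (`T4WeightBudget.RelWeightBound`; the cell's OWN estimate — NOT PRINTED in [Bałaban 1983–89],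
NOT PROVED).  Crux-route work under `Spine/NE7b/`; NOTHING of Bałaban's estimates is asserted; no `def` (the printed transports are the lambda
`fun j rt => hol V₀ (qb j.1) (treeWord (boxVec n rt.1) ++ seg j.2 rt.2)`, the lift of a torus field is `fun x ν => B (tcls (nM) x) ν`); zero `sorry`; no
`T4Continuum/Support` leaf (FREEZE (0)).  Imports BY NAME: this lineage's `…FullFormSineFloor` (FFSF: `ims_floor_full_form`) and `…AverageTermsPrinted` (ATP:
`exists_printed_transports`' witnesses written out — `Q0cov_eq_weighted_sum`, `tcls_qb_add_boxVec_add`; `B7Prop1Explicit.hol_mem`).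

WHY.  FFSF displays the average family of the (h2) slot's full form through a weight `ω`, transports `w′ ∈ U1` and a functional `Y` with
`hY : Y j B = ‖ω • Σ_{(r,t)} conjR (w′ j (r,t)) (B (ιA j (r,t)).1 (ιA j (r,t)).2)‖` — parameters, because WHICH operator is print's `Q₁(V)` at `k = 1` is the
OWNER's (A3) call.  ATP proved that the first candidate, [B7] (125)'s main term `Q₀(V₀)` (`B7Prop3GeneralLinear.Q0cov`) read at the block base points `n·y` on
the periodic lift of a torus field, HAS that shape with `ω = n^{−(d+1)}` and the printed transports.  THIS FILE is the one-`exact` junction: FFSF with those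
binders inhabited, so that the average side of the displayed functional is print's own `Σ_{(y,κ)} |(Q₀(V₀)B)(n·y, κ)|²` — for ANY background `V₀` in the
unit-ball class on `ℤ^d` (no periodicity of `V₀` is used by the identity; for the torus background one takes the periodic lift).  The `n^{d−2}` prefactor of
`F^{full}` and the choice `Q₀` vs the full linear part `L(Q(V₀)·)` of (122)∕(124) stay displayed choices (Q-leaf05-g157-1).

WHAT IS PROVED ([folklore]): §1 **`ims_floor_full_form_printed`** — FFSF `ims_floor_full_form` with `ω := ((n:ℝ)^(d+1))⁻¹`,
`w′ := fun j rt => hol V₀ (qb j.1) (treeWord (boxVec n rt.1) ++ seg j.2 rt.2)` (`hw′ := hol_mem`), `Y j B := ‖Q0cov n V₀ (fun x ν => B (tcls (nM) x) ν) (qb j.1) j.2‖`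
(`hY := ATP`): binders `(n M L Mp) … (hN : n·M = Mp·L) (c₀)` · curl data `(ι hι w hw R hR X hX)` as COSF ∕ FFSF · base points `(qb, hqb : qb y i = n·y_i)` · TAI's
`(ιA, hιA)` · background `(V₀, hV : ∀ x κ, V₀ x κ ∈ U1)` · average maps `(R′, hR′)` at the printed `(ω, w′)` · `(good) (hloc)` · `(ht) (x hx)` ⊢
`((c_loc − (1+t⁻¹)·(2^d·1²·(π∕(2L))²·4·2(d−1) + (n^{d+1}+1)2^d·(|n^{−(d+1)}|·n)²·((d+1)(n−1)·π∕(2L))²·n^{d+1}·n))∕(1+t))·Σ_c‖x c‖²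
   ≤ Σ_P X P (fun y μ => x (y,μ))² + Σ_j ‖Q0cov n V₀ (fun z ν => x (tcls (nM) z, ν)) (qb j.1) j.2‖²`.
§2 **`ims_floor_full_form_printed_weighted`** — the same with `F^{full}`'s prefactor `n^{d−2}` ON THE AVERAGE PART, i.e. the right-hand side
`Σ_P X_P(B)² + n^{d−2}·Σ_j ‖(Q₀(V₀)(lift B))(n·j.1, j.2)‖²` (SectE-interface-proof §5.5's `F_V^{full}` with `Q₁(V) := Q₀(V₀)`): the weight is taken INSIDE the square as
`ω := √(n^{d−2})·(n^{d+1})⁻¹` (OWNER W-ne7bp1-g114-13: «a weight kept OUTSIDE the square is the same functional with `ω ↦ n^{(d−2)∕2}·ω` inside, uniformly in `j`»),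
so `ε_avg` carries `(|√(n^{d−2})·(n^{d+1})⁻¹|·n)²` `= n^{−d−2}`; proof = §1's `hY` with `norm_smul` and `(√a·x)² = a·x²` on the right-hand side.
By value (§1): `|n^{−(d+1)}|·n = n^{−d}`, so `ε_avg·L² = (n^{d+1}+1)·2^d·n^{−2d}·((d+1)(n−1))²·(π²∕4)·n^{d+2} = (n^{d+1}+1)(d+1)²(n−1)²·2^d·π²·n^{2−d}∕4`; d = 4, n = 2:
`33·25·1·16·π²∕16 = 825π² ≈ 8 142` (vs `ε_curl·L² = 96π² ≈ 947`) — informative at t = 1, c_loc = 1 iff `L ≥ 135`; crude letters (TAI docstring), sharp ones later if wanted.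

NOT HERE (honest): the local floor `c_loc` (Lemma 5.5, per-cube gauge letters, currency Q-leaf05-g157-1), `good`, the curl transports `w` (CCTL's `V̄₀`-products are
one instance), the (A3) decision `Q₀` vs `L(Q(V₀)·)`, the `n^{d−2}` prefactor; anything of Bałaban's estimates.
BY-NAME EFFECT ON THE WALL: NONE.  NE7b NOT PRINTED ∕ NOT PROVED; spine PROVED 0∕9; rung (B)+1 on ONE finite T⁴ — NOT infinite volume, NOT the mass gap, NOT Clay.
HONEST DEPENDENCY: continuum YM on T⁴ ⇐ BetaPertH ∧ nine spine estimates (0/9 proved); BetaPertH ⇐ (D1) ∧ (D4) ∧ CAP+tail; G-an2-4 gates asym, D1 and NE2/3/4.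
-/

set_option autoImplicit false

noncomputable section

open Finset
open Literature.MathematicalPhysics.QuantumFieldTheory.Balaban1983to89.B14.TentUnityTorus (tentZ)
open Literature.MathematicalPhysics.QuantumFieldTheory.Balaban1983to89.B7Prop1Explicit (Site seg hol treeWord boxVec U1 hol_mem)
open Literature.MathematicalPhysics.QuantumFieldTheory.Balaban1983to89.B7Eq78Linearization (conjR conjR_add conjR_smul_real)
open Literature.MathematicalPhysics.QuantumFieldTheory.Balaban1983to89.B7Prop3GeneralLinear (Q0cov)
open Literature.MathematicalPhysics.QuantumFieldTheory.Balaban1983to89.T4TermwiseTorus (tcls)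
open Summit.QuantumFields.BalabanUV.T4Continuum.NE7b.FullFormSineFloor (ims_floor_full_form)
open Summit.QuantumFields.BalabanUV.T4Continuum.NE7b.AverageTermsPrinted (Q0cov_eq_weighted_sum tcls_qb_add_boxVec_add)

namespace Summit.QuantumFields.BalabanUV.T4Continuum.NE7b.FullFormSineFloorPrinted

variable {d : ℕ}
variable {𝔸 : Type*} [NormedRing 𝔸] [NormedAlgebra ℂ 𝔸] [NormOneClass 𝔸] [CompleteSpace 𝔸]

omit [CompleteSpace 𝔸] in
/-- **THE FULL-FORM (h2) FLOOR AT k = 1, AVERAGE FAMILY = PRINT's (125)** (see the module docstring; FFSF `ims_floor_full_form` with `(ω, w′, hw′, Y, hY)` inhabited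
by ATP's unfolding of `Q0cov`).  Displayed: the local floor `c_loc` on `good`, the curl transports `w`, the background `V₀ ∈ U1`. [folklore] -/
theorem ims_floor_full_form_printed (n M L Mp : ℕ) [NeZero n] [NeZero M] [NeZero (n * M)] [Fact (1 < n * M)] [NeZero Mp]
    (hL : 0 < L) (hMp : 2 ≤ Mp) (hN : n * M = Mp * L) (c₀ : ℕ)
    -- the curl family (CTL ∕ TPI): plaquette-to-bonds map, transports, maps by position, the curl functional
    (ι : (Fin d → ZMod (n * M)) × {a : Fin d × Fin d // a.1 < a.2} → Fin 4 → (Fin d → ZMod (n * M)) × Fin d)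
    (hι : ∀ x a, ι (x, a) = ![(x, a.1.1), (x + Pi.single a.1.1 1, a.1.2), (x + Pi.single a.1.2 1, a.1.1), (x, a.1.2)])
    (w : (Fin d → ZMod (n * M)) × {a : Fin d × Fin d // a.1 < a.2} → Fin 3 → 𝔸ˣ) (hw : ∀ P i, w P i ∈ U1 𝔸)
    (R : (Fin d → ZMod (n * M)) × {a : Fin d × Fin d // a.1 < a.2} → (Fin d → ZMod (n * M)) × Fin d → 𝔸 →ₗ[ℝ] 𝔸)
    (hR : ∀ P c, R P c =
        if c = ι P 0 then LinearMap.id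
        else if c = ι P 1 then LinearMap.mk ⟨conjR (w P 0), conjR_add (w P 0)⟩ (conjR_smul_real (w P 0))
        else if c = ι P 2 then -LinearMap.mk ⟨conjR (w P 1), conjR_add (w P 1)⟩ (conjR_smul_real (w P 1))
        else if c = ι P 3 then -LinearMap.mk ⟨conjR (w P 2), conjR_add (w P 2)⟩ (conjR_smul_real (w P 2))
        else 0)
    (X : (Fin d → ZMod (n * M)) × {a : Fin d × Fin d // a.1 < a.2} → ((Fin d → ZMod (n * M)) → Fin d → 𝔸) → ℝ)
    (hX : ∀ (y : Fin d → ZMod (n * M)) (a : {a : Fin d × Fin d // a.1 < a.2}) (B : (Fin d → ZMod (n * M)) → Fin d → 𝔸), X (y, a) B =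
      ‖B y a.1.1 + conjR (w (y, a) 0) (B (y + Pi.single a.1.1 1) a.1.2) - conjR (w (y, a) 1) (B (y + Pi.single a.1.2 1) a.1.1)
        - conjR (w (y, a) 2) (B y a.1.2)‖)
    -- the average family read from print: base points, TAI's incidence, the background on `ℤ^d`, ATL's maps at the printed weight and transports
    (qb : (Fin d → ZMod M) → Site d) (hqb : ∀ y i, qb y i = (n : ℤ) * (((y i).val : ℕ) : ℤ))
    (ιA : (Fin d → ZMod M) × Fin d → (Fin d → Fin n) × Fin n → (Fin d → ZMod (n * M)) × Fin d)
    (hιA : ∀ y κ r t, ιA (y, κ) (r, t) =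
      ((fun i => (((y i).val * n + (r i : ℕ) : ℕ) : ZMod (n * M))) + Pi.single κ ((t : ℕ) : ZMod (n * M)), κ))
    (V₀ : Site d → Fin d → 𝔸ˣ) (hV : ∀ x κ, V₀ x κ ∈ U1 𝔸)
    (R' : (Fin d → ZMod M) × Fin d → (Fin d → ZMod (n * M)) × Fin d → 𝔸 →ₗ[ℝ] 𝔸)
    (hR' : ∀ j c, R' j c = (((n : ℝ) ^ (d + 1))⁻¹) • ∑ rt ∈ Finset.univ.filter (fun rt => ιA j rt = c),
        LinearMap.mk ⟨conjR (hol V₀ (qb j.1) (treeWord (boxVec n rt.1) ++ seg j.2 ((rt.2 : ℕ) : ℤ))),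
          conjR_add (hol V₀ (qb j.1) (treeWord (boxVec n rt.1) ++ seg j.2 ((rt.2 : ℕ) : ℤ)))⟩
          (conjR_smul_real (hol V₀ (qb j.1) (treeWord (boxVec n rt.1) ++ seg j.2 ((rt.2 : ℕ) : ℤ)))))
    -- the displayed input: admissibility and the local floors of the localised fields
    (good : ((Fin d → ZMod (n * M)) × Fin d → 𝔸) → Prop) {cloc : ℝ}
    (hloc : ∀ (S : Fin d → ZMod Mp) (x : (Fin d → ZMod (n * M)) × Fin d → 𝔸), good x →
      cloc * ∑ c, ‖(∏ ν, Real.sin (Real.pi / 2 * tentZ (L : ℝ) (c.1 ν - (((S ν).val * L + c₀ : ℕ) : ZMod (n * M))))) • x c‖ ^ 2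
        ≤ ∑ P, ‖∑ c ∈ Finset.univ.image (ι P),
              R P c ((∏ ν, Real.sin (Real.pi / 2 * tentZ (L : ℝ) (c.1 ν - (((S ν).val * L + c₀ : ℕ) : ZMod (n * M))))) • x c)‖ ^ 2
          + ∑ j, ‖∑ c ∈ Finset.univ.image (ιA j),
              R' j c ((∏ ν, Real.sin (Real.pi / 2 * tentZ (L : ℝ) (c.1 ν - (((S ν).val * L + c₀ : ℕ) : ZMod (n * M))))) • x c)‖ ^ 2)
    {t : ℝ} (ht : 0 < t) (x : (Fin d → ZMod (n * M)) × Fin d → 𝔸) (hx : good x) :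
    (cloc - (1 + t⁻¹) * ((((2 ^ Fintype.card (Fin d) : ℕ)) : ℝ) * (1 : ℝ) ^ 2 * (Real.pi / (2 * L)) ^ 2 * (4 : ℕ) * (2 * (d - 1) : ℕ)
        + (((n ^ (d + 1) + 1) * 2 ^ Fintype.card (Fin d) : ℕ) : ℝ) * (|((n : ℝ) ^ (d + 1))⁻¹| * n) ^ 2
            * (((d + 1) * (n - 1) : ℕ) * (Real.pi / (2 * L))) ^ 2 * (n ^ (d + 1) : ℕ) * (n : ℕ))) / (1 + t)
        * ∑ c, ‖x c‖ ^ 2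
      ≤ ∑ P, X P (fun y μ => x (y, μ)) ^ 2
        + ∑ j : (Fin d → ZMod M) × Fin d, ‖Q0cov n V₀ (fun z ν => x (tcls (n * M) z, ν)) (qb j.1) j.2‖ ^ 2 := by
  refine ims_floor_full_form n M L Mp hL hMp hN c₀ ι hι w hw R hR X hX ιA hιA (((n : ℝ) ^ (d + 1))⁻¹)
    (fun j rt => hol V₀ (qb j.1) (treeWord (boxVec n rt.1) ++ seg j.2 ((rt.2 : ℕ) : ℤ))) (fun j rt => hol_mem hV _ _) R' hR'
    (fun j B => ‖Q0cov n V₀ (fun z ν => B (tcls (n * M) z) ν) (qb j.1) j.2‖) ?_ good hloc ht x hx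
  rintro ⟨y, κ⟩ B
  rw [Q0cov_eq_weighted_sum]
  congr 2
  refine Finset.sum_congr rfl fun rt _ => ?_
  obtain ⟨r, s⟩ := rt
  rw [hιA, tcls_qb_add_boxVec_add n M qb hqb y κ r s]

/-! ## §2 `F^{full}`'s prefactor `n^{d−2}` on the average part: the weight `√(n^{d−2})·n^{−(d+1)}` inside the square -/

omit [CompleteSpace 𝔸] in
/-- **THE FULL-FORM (h2) FLOOR AT k = 1 FOR `Σ_P X_P(B)² + n^{d−2}·Σ_j ‖(Q₀(V₀)B)(n·y, κ)‖²`** — §1 with the prefactor of the printed full form absorbed into the weight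
(`ω := √(n^{d−2})·(n^{d+1})⁻¹`; OWNER W-ne7bp1-g114-13). [folklore] -/
theorem ims_floor_full_form_printed_weighted (n M L Mp : ℕ) [NeZero n] [NeZero M] [NeZero (n * M)] [Fact (1 < n * M)] [NeZero Mp]
    (hL : 0 < L) (hMp : 2 ≤ Mp) (hN : n * M = Mp * L) (c₀ : ℕ)
    (ι : (Fin d → ZMod (n * M)) × {a : Fin d × Fin d // a.1 < a.2} → Fin 4 → (Fin d → ZMod (n * M)) × Fin d)
    (hι : ∀ x a, ι (x, a) = ![(x, a.1.1), (x + Pi.single a.1.1 1, a.1.2), (x + Pi.single a.1.2 1, a.1.1), (x, a.1.2)])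
    (w : (Fin d → ZMod (n * M)) × {a : Fin d × Fin d // a.1 < a.2} → Fin 3 → 𝔸ˣ) (hw : ∀ P i, w P i ∈ U1 𝔸)
    (R : (Fin d → ZMod (n * M)) × {a : Fin d × Fin d // a.1 < a.2} → (Fin d → ZMod (n * M)) × Fin d → 𝔸 →ₗ[ℝ] 𝔸)
    (hR : ∀ P c, R P c =
        if c = ι P 0 then LinearMap.id
        else if c = ι P 1 then LinearMap.mk ⟨conjR (w P 0), conjR_add (w P 0)⟩ (conjR_smul_real (w P 0))
        else if c = ι P 2 then -LinearMap.mk ⟨conjR (w P 1), conjR_add (w P 1)⟩ (conjR_smul_real (w P 1))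
        else if c = ι P 3 then -LinearMap.mk ⟨conjR (w P 2), conjR_add (w P 2)⟩ (conjR_smul_real (w P 2))
        else 0)
    (X : (Fin d → ZMod (n * M)) × {a : Fin d × Fin d // a.1 < a.2} → ((Fin d → ZMod (n * M)) → Fin d → 𝔸) → ℝ)
    (hX : ∀ (y : Fin d → ZMod (n * M)) (a : {a : Fin d × Fin d // a.1 < a.2}) (B : (Fin d → ZMod (n * M)) → Fin d → 𝔸), X (y, a) B =
      ‖B y a.1.1 + conjR (w (y, a) 0) (B (y + Pi.single a.1.1 1) a.1.2) - conjR (w (y, a) 1) (B (y + Pi.single a.1.2 1) a.1.1)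
        - conjR (w (y, a) 2) (B y a.1.2)‖)
    (qb : (Fin d → ZMod M) → Site d) (hqb : ∀ y i, qb y i = (n : ℤ) * (((y i).val : ℕ) : ℤ))
    (ιA : (Fin d → ZMod M) × Fin d → (Fin d → Fin n) × Fin n → (Fin d → ZMod (n * M)) × Fin d)
    (hιA : ∀ y κ r t, ιA (y, κ) (r, t) =
      ((fun i => (((y i).val * n + (r i : ℕ) : ℕ) : ZMod (n * M))) + Pi.single κ ((t : ℕ) : ZMod (n * M)), κ))
    (V₀ : Site d → Fin d → 𝔸ˣ) (hV : ∀ x κ, V₀ x κ ∈ U1 𝔸)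
    (R' : (Fin d → ZMod M) × Fin d → (Fin d → ZMod (n * M)) × Fin d → 𝔸 →ₗ[ℝ] 𝔸)
    (hR' : ∀ j c, R' j c = (Real.sqrt ((n : ℝ) ^ (d - 2)) * ((n : ℝ) ^ (d + 1))⁻¹) • ∑ rt ∈ Finset.univ.filter (fun rt => ιA j rt = c),
        LinearMap.mk ⟨conjR (hol V₀ (qb j.1) (treeWord (boxVec n rt.1) ++ seg j.2 ((rt.2 : ℕ) : ℤ))),
          conjR_add (hol V₀ (qb j.1) (treeWord (boxVec n rt.1) ++ seg j.2 ((rt.2 : ℕ) : ℤ)))⟩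
          (conjR_smul_real (hol V₀ (qb j.1) (treeWord (boxVec n rt.1) ++ seg j.2 ((rt.2 : ℕ) : ℤ)))))
    (good : ((Fin d → ZMod (n * M)) × Fin d → 𝔸) → Prop) {cloc : ℝ}
    (hloc : ∀ (S : Fin d → ZMod Mp) (x : (Fin d → ZMod (n * M)) × Fin d → 𝔸), good x →
      cloc * ∑ c, ‖(∏ ν, Real.sin (Real.pi / 2 * tentZ (L : ℝ) (c.1 ν - (((S ν).val * L + c₀ : ℕ) : ZMod (n * M))))) • x c‖ ^ 2
        ≤ ∑ P, ‖∑ c ∈ Finset.univ.image (ι P),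
              R P c ((∏ ν, Real.sin (Real.pi / 2 * tentZ (L : ℝ) (c.1 ν - (((S ν).val * L + c₀ : ℕ) : ZMod (n * M))))) • x c)‖ ^ 2
          + ∑ j, ‖∑ c ∈ Finset.univ.image (ιA j),
              R' j c ((∏ ν, Real.sin (Real.pi / 2 * tentZ (L : ℝ) (c.1 ν - (((S ν).val * L + c₀ : ℕ) : ZMod (n * M))))) • x c)‖ ^ 2)
    {t : ℝ} (ht : 0 < t) (x : (Fin d → ZMod (n * M)) × Fin d → 𝔸) (hx : good x) :
    (cloc - (1 + t⁻¹) * ((((2 ^ Fintype.card (Fin d) : ℕ)) : ℝ) * (1 : ℝ) ^ 2 * (Real.pi / (2 * L)) ^ 2 * (4 : ℕ) * (2 * (d - 1) : ℕ)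
        + (((n ^ (d + 1) + 1) * 2 ^ Fintype.card (Fin d) : ℕ) : ℝ) * (|Real.sqrt ((n : ℝ) ^ (d - 2)) * ((n : ℝ) ^ (d + 1))⁻¹| * n) ^ 2
            * (((d + 1) * (n - 1) : ℕ) * (Real.pi / (2 * L))) ^ 2 * (n ^ (d + 1) : ℕ) * (n : ℕ))) / (1 + t)
        * ∑ c, ‖x c‖ ^ 2
      ≤ ∑ P, X P (fun y μ => x (y, μ)) ^ 2
        + (n : ℝ) ^ (d - 2) * ∑ j : (Fin d → ZMod M) × Fin d, ‖Q0cov n V₀ (fun z ν => x (tcls (n * M) z, ν)) (qb j.1) j.2‖ ^ 2 := by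
  have hY : ∀ (j : (Fin d → ZMod M) × Fin d) (B : (Fin d → ZMod (n * M)) → Fin d → 𝔸),
      Real.sqrt ((n : ℝ) ^ (d - 2)) * ‖Q0cov n V₀ (fun z ν => B (tcls (n * M) z) ν) (qb j.1) j.2‖
        = ‖(Real.sqrt ((n : ℝ) ^ (d - 2)) * ((n : ℝ) ^ (d + 1))⁻¹) • ∑ rt : (Fin d → Fin n) × Fin n,
            conjR (hol V₀ (qb j.1) (treeWord (boxVec n rt.1) ++ seg j.2 ((rt.2 : ℕ) : ℤ))) (B (ιA j rt).1 (ιA j rt).2)‖ := by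
    rintro ⟨y, κ⟩ B
    rw [Q0cov_eq_weighted_sum, mul_smul, norm_smul (Real.sqrt _), Real.norm_eq_abs, abs_of_nonneg (Real.sqrt_nonneg _)]
    congr 3
    refine Finset.sum_congr rfl fun rt _ => ?_
    obtain ⟨r, s⟩ := rt
    rw [hιA, tcls_qb_add_boxVec_add n M qb hqb y κ r s]
  have key := ims_floor_full_form n M L Mp hL hMp hN c₀ ι hι w hw R hR X hX ιA hιA
    (Real.sqrt ((n : ℝ) ^ (d - 2)) * ((n : ℝ) ^ (d + 1))⁻¹)
    (fun j rt => hol V₀ (qb j.1) (treeWord (boxVec n rt.1) ++ seg j.2 ((rt.2 : ℕ) : ℤ))) (fun j rt => hol_mem hV _ _) R' hR'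
    (fun j B => Real.sqrt ((n : ℝ) ^ (d - 2)) * ‖Q0cov n V₀ (fun z ν => B (tcls (n * M) z) ν) (qb j.1) j.2‖) hY good hloc ht x hx
  have hsq : ∀ j : (Fin d → ZMod M) × Fin d,
      (Real.sqrt ((n : ℝ) ^ (d - 2)) * ‖Q0cov n V₀ (fun z ν => x (tcls (n * M) z, ν)) (qb j.1) j.2‖) ^ 2
        = (n : ℝ) ^ (d - 2) * ‖Q0cov n V₀ (fun z ν => x (tcls (n * M) z, ν)) (qb j.1) j.2‖ ^ 2 := fun j => by
    rw [mul_pow, Real.sq_sqrt (by positivity)]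
  simp_rw [hsq, ← Finset.mul_sum] at key
  exact key

end Summit.QuantumFields.BalabanUV.T4Continuum.NE7b.FullFormSineFloorPrinted

end
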